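import Summits.AtomisticToContinuum.HydrodynamicLimit.Theorems.AnnealedZeroHorizonAnnealedWeakStrongHsRelEtaCoerciveA

/-!
# Route `AnnealedZeroHorizon`, crux `AnnealedWeakStrong` (stmt-AtomisticToContinuum-9258), line `registered` —
# stub S3a `stub_hsRelEtaCoercive`: pointwise coercivity of the hard-sphere relative entropy on the cone

Proof file (`--supports stmt-AtomisticToContinuum-9258`) for the registered stub
`stub_hsRelEtaCoercive : Sig.stub_hsRelEtaCoercive` of the skeleton of the line `registered` (lead
`prover-line-stmt-AtomisticToContinuum-9258-c1`). Pure real analysis on the Bregman divergence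
`hsRelEta σ U V̄ = η_σ(U) − η_σ(V̄) − Dη_σ(V̄)(U − V̄)` of the hard-sphere entropy `hsEta σ` for reference
states `V̄ = consState r w ϑ` in a compact physical dilute range and states `U` of the realizable cone
`{0 ≤ ρ, 0 ≤ E, ‖m‖² ≤ 2ρE}` (Lean junk included). All the calculus is in part A
(`…HsRelEtaCoerciveA`, packaged as `hsRelEtaConeLower`):

* (i) `0 ≤ hsRelEta σ U V̄` at physical `U` of ANY density and (iii, physical case) the two-regime bound
  `(m_I/2) min(‖U − V̄‖², ‖U − V̄‖) ≤ hsRelEta σ U V̄`, from the primitive-variable splitting into three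
  non-negative ideal terms plus the excess Bregman term, `T₁ + 2T₄ ≥ 0` without packing cap on `U`;
* (ii) linear growth `stateDist U V̄ ≤ A + B·hsRelEta σ U V̄` on the whole cone and (iii, vacuum case)
  `hsRelEta σ U V̄ ≥ ρm/4` for `ρ_U ≤ r₀`, from the cone bound
  `E/(4ϑ) + ρ log ρ − C ρ + r Z ≤ hsRelEta σ U V̄` (`r Z ≥ (3/4) r` at packing `≤ 1/(4C₁)`), the
  elementary `x log x − Cx ≥ −e^{C−1}` and `x log x ≥ −2√x`.
-/

noncomputable section

open Set

namespace Summit.AtomisticToContinuum.HydrodynamicLimit.Theorems.AWS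

open Literature.MathematicalPhysics.KineticTheory

/-! ### Scalar tools -/

/-- `x log x − C x ≥ −e^{C−1}` for `x ≥ 0` (the minimum is at `log x = C − 1`). -/
theorem neg_exp_le_mul_log_sub {x : ℝ} (hx : 0 ≤ x) (C : ℝ) :
    -Real.exp (C - 1) ≤ x * Real.log x - C * x := by
  rcases hx.eq_or_lt with h | h
  · rw [← h]; simp [Real.exp_nonneg]
  · have h1 := Real.one_sub_inv_le_log_of_pos (div_pos h (Real.exp_pos (C - 1)))
    rw [Real.log_div h.ne' (Real.exp_pos _).ne', Real.log_exp] at h1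
    have h2 : x * (1 - (x / Real.exp (C - 1))⁻¹) = x - Real.exp (C - 1) := by
      field_simp
    nlinarith [mul_le_mul_of_nonneg_left h1 hx]

/-- Small densities: `−2t ≤ x log x` for `0 ≤ x ≤ t²`, `0 < t` (`log √x ≥ 1 − 1/√x`). -/
theorem mul_log_ge_of_le_sq {x t : ℝ} (hx : 0 ≤ x) (hxt : x ≤ t ^ 2) (ht : 0 < t) :
    -(2 * t) ≤ x * Real.log x := by
  rcases hx.eq_or_lt with h | h
  · rw [← h]; simp [ht.le]
  · set s := Real.sqrt x with hs
    have hs0 : 0 < s := Real.sqrt_pos.2 h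
    have hsx : s ^ 2 = x := Real.sq_sqrt hx
    have hst : s ≤ t := by
      rw [hs, ← Real.sqrt_sq ht.le]
      exact Real.sqrt_le_sqrt hxt
    have hlog : Real.log x = 2 * Real.log s := by
      rw [hs, Real.log_sqrt hx]; ring
    have h1 := Real.one_sub_inv_le_log_of_pos hs0
    have h2 : s * (1 - s⁻¹) = s - 1 := by field_simp
    rw [hlog, ← hsx]
    nlinarith [mul_le_mul_of_nonneg_left h1 hs0.le]

/-- `|log x| ≤ |log a| + |log b|` for `0 < a ≤ x ≤ b`. -/
theorem abs_log_le_of_mem {a b x : ℝ} (ha : 0 < a) (hax : a ≤ x) (hxb : x ≤ b) :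
    |Real.log x| ≤ |Real.log a| + |Real.log b| := by
  have hx : 0 < x := ha.trans_le hax
  have h1 : Real.log a ≤ Real.log x := Real.log_le_log ha hax
  have h2 : Real.log x ≤ Real.log b := Real.log_le_log hx hxb
  rw [abs_le]
  constructor <;> linarith [neg_abs_le (Real.log a), le_abs_self (Real.log b), abs_nonneg (Real.log a),
    abs_nonneg (Real.log b)]

/-- The state distance is dominated by the sup norm: `stateDist U V ≤ 3 ‖U − V‖`. -/
theorem stateDist_le_norm (U V : State) : stateDist U V ≤ 3 * ‖U - V‖ := by
  have h1 : |U.1 - V.1| ≤ ‖U - V‖ := by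
    have := norm_fst_le (U - V)
    simpa only [Prod.fst_sub, Real.norm_eq_abs] using this
  have h2 : ‖U.2.1 - V.2.1‖ ≤ ‖U - V‖ := by
    have := (norm_fst_le (U - V).2).trans (norm_snd_le (U - V))
    simpa only [Prod.snd_sub, Prod.fst_sub] using this
  have h3 : |U.2.2 - V.2.2| ≤ ‖U - V‖ := by
    have := (norm_snd_le (U - V).2).trans (norm_snd_le (U - V))
    simpa only [Prod.snd_sub, Real.norm_eq_abs] using this
  unfold stateDist
  linarith

/-- On the cone the momentum is controlled by mass and energy: `|m| ≤ ρ + E/2`. -/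
theorem norm_mom_le_cone {U : State} (hU1 : 0 ≤ U.1) (hU2 : 0 ≤ U.2.2)
    (hU3 : ‖U.2.1‖ ^ 2 ≤ 2 * U.1 * U.2.2) : ‖U.2.1‖ ≤ U.1 + U.2.2 / 2 := by
  have hsq : ‖U.2.1‖ ^ 2 ≤ (U.1 + U.2.2 / 2) ^ 2 := by nlinarith [sq_nonneg (U.1 - U.2.2 / 2)]
  exact (abs_le_of_sq_le_sq' hsq (by positivity)).2

/-! ### The registered stub S3a -/

/-- **S3a — pointwise coercivity of the hard-sphere relative entropy on the realizable cone (pure real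
analysis; size M–L).** There is a packing threshold `η > 0` such that for every compact range of reference
states `V̄ = consState r w ϑ` (`r ∈ [ρm, ρM]`, `‖w‖ ≤ UM`, `ϑ ∈ [θm, θM]`, all positive) and every `σ > 0` with
`ρM σ³ < η`, on the cone `{U | 0 ≤ ρ, 0 ≤ E, ‖m‖² ≤ 2ρE}` of states the mollified empirical fields can take:
(i) `η_σ(U | V̄) ≥ 0` at every PHYSICAL state (`ρ > 0`, `‖m‖² < 2ρE`, i.e. `θ(U) > 0`) — convexity of `η_σ` on the
dilute band (`HsEntropyConvex`) near `V̄`, and `η_σ ≥ η_0` (`f_ex ≥ 0`) + the explicit ideal-gas relative entropy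
`ρ log(ρ/ρ̄) − ρ + ρ̄ + (3/2)ρ h(θ/θ̄) + ρ|u − ū|²/(2θ̄)` for dense states; (ii) linear growth
`dist(U, V̄) ≤ A + B η_σ(U | V̄)` on the WHOLE cone (junk included: at cold states `θ(U) = 0`, `Real.log 0 = 0`, the
linear part `E/θ̄ − ū·m/θ̄` still dominates); (iii) a forcing bound: for every `δ > 0` there are `μ > 0` and a
vacuum radius `r₀ > 0` with `η_σ(U | V̄) ≥ μ` whenever `dist(U, V̄) ≥ δ` and `U` is physical OR has `ρ ≤ r₀` (this
covers vacuum, `η_σ(0 | V̄) = ρ̄ Z(ρ̄σ³) = p̄/θ̄`, and the single-particle cold windows, whose density is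
`≤ ‖k‖_∞/(N+1) → 0`). Deliberately NOT claimed: coercivity at cold junk states of density `O(1)` — there
`η_σ(U|V̄) = (3/2)ρ̄(log θ̄ − 1)` can be negative; they need `≥ 2` particles with equal velocities, a
Liouville-null event handled in S3b. Leans on: `hsEntropyConvex_proof'`, `hsEosLowDensity_proof` (analytic
`f_ex` near `0`, `f_ex(0) = 0`, `f_ex ≥ 0`). -/
def Sig.stub_hsRelEtaCoercive : Prop :=
  ∃ η : ℝ, 0 < η ∧
    ∀ (ρm ρM θm θM UM σ : ℝ), 0 < ρm → ρm ≤ ρM → 0 < θm → θm ≤ θM → 0 ≤ UM → 0 < σ →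
      ρM * σ ^ 3 < η →
      (∀ (r : ℝ) (w : V3) (ϑ : ℝ), ρm ≤ r → r ≤ ρM → ‖w‖ ≤ UM → θm ≤ ϑ → ϑ ≤ θM →
          ∀ U : State, 0 < U.1 → ‖U.2.1‖ ^ 2 < 2 * U.1 * U.2.2 → 0 ≤ hsRelEta σ U (consState r w ϑ)) ∧
      (∃ A B : ℝ, 0 ≤ A ∧ 0 ≤ B ∧
          ∀ (r : ℝ) (w : V3) (ϑ : ℝ), ρm ≤ r → r ≤ ρM → ‖w‖ ≤ UM → θm ≤ ϑ → ϑ ≤ θM →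
            ∀ U : State, 0 ≤ U.1 → 0 ≤ U.2.2 → ‖U.2.1‖ ^ 2 ≤ 2 * U.1 * U.2.2 →
              stateDist U (consState r w ϑ) ≤ A + B * hsRelEta σ U (consState r w ϑ)) ∧
      (∀ δ : ℝ, 0 < δ → ∃ μ : ℝ, 0 < μ ∧ ∃ r₀ : ℝ, 0 < r₀ ∧
          ∀ (r : ℝ) (w : V3) (ϑ : ℝ), ρm ≤ r → r ≤ ρM → ‖w‖ ≤ UM → θm ≤ ϑ → ϑ ≤ θM →
            ∀ U : State, 0 ≤ U.1 → 0 ≤ U.2.2 → ‖U.2.1‖ ^ 2 ≤ 2 * U.1 * U.2.2 →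
              (‖U.2.1‖ ^ 2 < 2 * U.1 * U.2.2 ∨ U.1 ≤ r₀) →
                δ ≤ stateDist U (consState r w ϑ) → μ ≤ hsRelEta σ U (consState r w ϑ))

/-- **S3a `stub_hsRelEtaCoercive` (registered stub of the line `registered`, crux
stmt-AtomisticToContinuum-9258).** The threshold is the `η₁` of `hsRelEtaConeLower`; the constants are
`C_max` (a bound of `(3/2)|log 2ϑ| + 2|w|²/ϑ + |λ⁰|` uniform over the reference range), `m_I` (ideal
coercivity), `A = 2e^{C_max} + 6θM e^{C_max−1} + ρM(1 + UM + UM²/2 + (3/2)θM)`, `B = 2 + 6θM`,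
`μ = min((m_I/2) min(δ²/9, δ/3), ρm/4)`, `r₀ = min(1, ρm/(4(C_max + 2)))²`. -/
theorem stub_hsRelEtaCoercive : Sig.stub_hsRelEtaCoercive := by
  obtain ⟨η, C₁, hη, hC₁, hηC, hfb, hG, hP⟩ := hsRelEtaConeLower
  refine ⟨η, hη, ?_⟩
  intro ρm ρM θm θM UM σ hρm hρmM hθm hθmM hUM hσ hpack
  have hθM : 0 < θM := hθm.trans_le hθmM
  have hρM : 0 < ρM := hρm.trans_le hρmM
  have hσ3 : 0 < σ ^ 3 := by positivity
  -- uniform constants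
  obtain ⟨Cmax, hCmax_def⟩ : ∃ C : ℝ, C = 3 / 2 * (|Real.log (2 * θm)| + |Real.log (2 * θM)|) +
      2 * UM ^ 2 / θm + (|Real.log ρm| + |Real.log ρM| + 1 / 2 +
        3 / 2 * (|Real.log θm| + |Real.log θM|) + UM ^ 2 / (2 * θm) + 5 / 2) := ⟨_, rfl⟩
  have hCmax0 : 0 ≤ Cmax := by rw [hCmax_def]; positivity
  obtain ⟨mI, hmI_def⟩ : ∃ m : ℝ, m = ρm * min 1 (1 / (2 * θM)) /
      (256 * (max 1 (ρM * (2 + UM + UM ^ 2 / 2 + 3 / 2 * θM))) ^ 2) := ⟨_, rfl⟩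
  have hmI0 : 0 < mI := by rw [hmI_def]; positivity
  -- facts about reference states in the range
  have href : ∀ (r : ℝ) (w : V3) (ϑ : ℝ), ρm ≤ r → r ≤ ρM → ‖w‖ ≤ UM → θm ≤ ϑ → ϑ ≤ θM →
      0 < r ∧ 0 < ϑ ∧ r * σ ^ 3 < η ∧
      3 / 2 * |Real.log (2 * ϑ)| + 2 * ‖w‖ ^ 2 / ϑ + |lam0 σ r w ϑ| ≤ Cmax ∧
      ρm / 2 ≤ r * (1 + r * σ ^ 3 * deriv hsExcessFreeEnergy (r * σ ^ 3)) := by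
    intro r w ϑ h1 h2 h3 h4 h5
    have hr0 : 0 < r := hρm.trans_le h1
    have hϑ0 : 0 < ϑ := hθm.trans_le h4
    have hxr : r * σ ^ 3 < η := lt_of_le_of_lt (mul_le_mul_of_nonneg_right h2 hσ3.le) hpack
    have hx0 : 0 < r * σ ^ 3 := by positivity
    obtain ⟨hf1, hf2⟩ := hfb (r * σ ^ 3) hx0 hxr
    have hf4 : |hsExcessFreeEnergy (r * σ ^ 3)| ≤ 1 / 4 :=
      hf1.trans ((mul_le_mul_of_nonneg_left hxr.le hC₁).trans (by rw [mul_comm]; exact hηC))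
    have hxf4 : |r * σ ^ 3 * deriv hsExcessFreeEnergy (r * σ ^ 3)| ≤ 1 / 4 := by
      rw [abs_mul, abs_of_pos hx0]
      exact (mul_le_mul hxr.le hf2 (abs_nonneg _) hη.le).trans hηC
    have hlogr := abs_log_le_of_mem hρm h1 h2
    have hlogϑ := abs_log_le_of_mem hθm h4 h5
    have hlog2ϑ : |Real.log (2 * ϑ)| ≤ |Real.log (2 * θm)| + |Real.log (2 * θM)| :=
      abs_log_le_of_mem (by positivity) (by linarith) (by linarith)
    have hw2 : ‖w‖ ^ 2 ≤ UM ^ 2 := pow_le_pow_left₀ (norm_nonneg w) h3 2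
    have hq1 : 2 * ‖w‖ ^ 2 / ϑ ≤ 2 * UM ^ 2 / θm :=
      div_le_div₀ (by positivity) (by linarith) hθm h4
    have hq2 : ‖w‖ ^ 2 / (2 * ϑ) ≤ UM ^ 2 / (2 * θm) :=
      div_le_div₀ (by positivity) hw2 (by positivity) (by linarith)
    have hq3 : 0 ≤ ‖w‖ ^ 2 / (2 * ϑ) := by positivity
    have hlam : |lam0 σ r w ϑ| ≤ |Real.log ρm| + |Real.log ρM| + 1 / 2 +
        3 / 2 * (|Real.log θm| + |Real.log θM|) + UM ^ 2 / (2 * θm) + 5 / 2 := by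
      obtain ⟨a1, a2⟩ := abs_le.1 hlogr
      obtain ⟨b1, b2⟩ := abs_le.1 hf4
      obtain ⟨c1, c2⟩ := abs_le.1 hxf4
      obtain ⟨d1, d2⟩ := abs_le.1 hlogϑ
      rw [abs_le, lam0]
      constructor <;> linarith
    rw [hCmax_def]
    have hZ : 3 / 4 ≤ 1 + r * σ ^ 3 * deriv hsExcessFreeEnergy (r * σ ^ 3) := by
      linarith [(abs_le.1 hxf4).1]
    refine ⟨hr0, hϑ0, hxr, by linarith, ?_⟩
    calc ρm / 2 ≤ ρm * (3 / 4) := by linarith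
      _ ≤ r * (1 + r * σ ^ 3 * deriv hsExcessFreeEnergy (r * σ ^ 3)) :=
        mul_le_mul h1 hZ (by norm_num) hr0.le
  -- the uniform lower bound on the whole cone
  have hcone : ∀ (r : ℝ) (w : V3) (ϑ : ℝ), ρm ≤ r → r ≤ ρM → ‖w‖ ≤ UM → θm ≤ ϑ → ϑ ≤ θM →
      ∀ U : State, 0 ≤ U.1 → 0 ≤ U.2.2 → ‖U.2.1‖ ^ 2 ≤ 2 * U.1 * U.2.2 →
        U.2.2 / (4 * θM) + (U.1 * Real.log U.1 - Cmax * U.1) + ρm / 2 ≤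
          hsRelEta σ U (consState r w ϑ) := by
    intro r w ϑ h1 h2 h3 h4 h5 U hU1 hU2 hU3
    obtain ⟨hr0, hϑ0, hxr, hCref, hZ⟩ := href r w ϑ h1 h2 h3 h4 h5
    have hGU := hG σ r ϑ w hσ hr0 hϑ0 hxr U hU1 hU2 hU3
    have e1 : U.2.2 / (4 * θM) ≤ U.2.2 / (4 * ϑ) :=
      div_le_div_of_nonneg_left hU2 (by positivity) (by linarith)
    have e2 := mul_le_mul_of_nonneg_right hCref hU1
    linarith
  -- the two-regime bound at physical states
  have hphys : ∀ (r : ℝ) (w : V3) (ϑ : ℝ), ρm ≤ r → r ≤ ρM → ‖w‖ ≤ UM → θm ≤ ϑ → ϑ ≤ θM →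
      ∀ U : State, 0 < U.1 → ‖U.2.1‖ ^ 2 < 2 * U.1 * U.2.2 →
        mI / 2 * min (‖U - consState r w ϑ‖ ^ 2) ‖U - consState r w ϑ‖ ≤
          hsRelEta σ U (consState r w ϑ) := by
    intro r w ϑ h1 h2 h3 h4 h5 U hU1 hU3
    obtain ⟨-, hϑ0, hxr, -, -⟩ := href r w ϑ h1 h2 h3 h4 h5
    have h := hP ρm ρM θM UM hρm hθM hUM σ r ϑ w hσ h1 h2 hϑ0 h5 h3 hxr U hU1 hU3
    rwa [← hmI_def] at h
  refine ⟨?_, ?_, ?_⟩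
  · -- (i) non-negativity at physical states
    intro r w ϑ h1 h2 h3 h4 h5 U hU1 hU3
    exact le_trans (by positivity) (hphys r w ϑ h1 h2 h3 h4 h5 U hU1 hU3)
  · -- (ii) linear growth on the whole cone
    refine ⟨2 * Real.exp Cmax + 6 * θM * Real.exp (Cmax - 1) +
      ρM * (1 + UM + UM ^ 2 / 2 + 3 / 2 * θM), 2 + 6 * θM, by positivity, by positivity, ?_⟩
    intro r w ϑ h1 h2 h3 h4 h5 U hU1 hU2 hU3
    have H := hcone r w ϑ h1 h2 h3 h4 h5 U hU1 hU2 hU3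
    have hL1 := neg_exp_le_mul_log_sub hU1 Cmax
    have hL2 := neg_exp_le_mul_log_sub hU1 (Cmax + 1)
    rw [add_sub_cancel_right] at hL2
    have hm := norm_mom_le_cone hU1 hU2 hU3
    have hϑ0 : 0 < ϑ := hθm.trans_le h4
    have hr0 : 0 < r := hρm.trans_le h1
    have hdist : stateDist U (consState r w ϑ) ≤
        2 * U.1 + 3 / 2 * U.2.2 + ρM * (1 + UM + UM ^ 2 / 2 + 3 / 2 * θM) := by
      unfold stateDist
      simp only [consState_fst, consState_snd_fst, consState_snd_snd, totalEnergyDensity]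
      have hw2 : ‖w‖ ^ 2 ≤ UM ^ 2 := pow_le_pow_left₀ (norm_nonneg w) h3 2
      have d1 : |U.1 - r| ≤ U.1 + r := abs_le.2 ⟨by linarith, by linarith⟩
      have d2 : ‖U.2.1 - r • w‖ ≤ ‖U.2.1‖ + r * UM := by
        refine (norm_sub_le _ _).trans ?_
        rw [norm_smul, Real.norm_eq_abs, abs_of_pos hr0]
        linarith [mul_le_mul_of_nonneg_left h3 hr0.le]
      have hE1 : 0 ≤ r * (‖w‖ ^ 2 / 2 + 3 / 2 * ϑ) := by positivity
      have hE2 : r * (‖w‖ ^ 2 / 2 + 3 / 2 * ϑ) ≤ r * (UM ^ 2 / 2 + 3 / 2 * θM) :=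
        mul_le_mul_of_nonneg_left (by linarith) hr0.le
      have d3 : |U.2.2 - r * (‖w‖ ^ 2 / 2 + 3 / 2 * ϑ)| ≤ U.2.2 + r * (UM ^ 2 / 2 + 3 / 2 * θM) :=
        abs_le.2 ⟨by linarith, by linarith⟩
      have d4 : r * (1 + UM + UM ^ 2 / 2 + 3 / 2 * θM) ≤ ρM * (1 + UM + UM ^ 2 / 2 + 3 / 2 * θM) :=
        mul_le_mul_of_nonneg_right h2 (by positivity)
      linarith
    have hE : U.2.2 / (4 * θM) ≤ hsRelEta σ U (consState r w ϑ) + Real.exp (Cmax - 1) := by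
      linarith
    rw [div_le_iff₀ (by positivity)] at hE
    have hρ : U.1 ≤ hsRelEta σ U (consState r w ϑ) + Real.exp Cmax := by
      have : 0 ≤ U.2.2 / (4 * θM) := by positivity
      linarith
    linarith [hdist, hE, hρ]
  · -- (iii) the forcing bound
    intro δ hδ
    refine ⟨min (mI / 2 * min ((δ / 3) ^ 2) (δ / 3)) (ρm / 4), by positivity, ?_⟩
    obtain ⟨t, ht_def⟩ : ∃ t : ℝ, t = min 1 (ρm / (4 * (Cmax + 2))) := ⟨_, rfl⟩
    have ht0 : 0 < t := by rw [ht_def]; positivity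
    have ht1 : t ≤ 1 := ht_def ▸ min_le_left _ _
    have ht2 : (Cmax + 2) * t ≤ ρm / 4 := by
      have h := min_le_right 1 (ρm / (4 * (Cmax + 2)))
      rw [← ht_def, le_div_iff₀ (by positivity)] at h
      linarith
    refine ⟨t ^ 2, by positivity, ?_⟩
    intro r w ϑ h1 h2 h3 h4 h5 U hU1 hU2 hU3 halt hδle
    rcases halt with hph | hsmall
    · have hU1' : 0 < U.1 := by
        rcases hU1.eq_or_lt with h0 | h0
        · rw [← h0, mul_zero, zero_mul] at hph
          exact absurd hph (not_lt.2 (sq_nonneg _))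
        · exact h0
      have hb := hphys r w ϑ h1 h2 h3 h4 h5 U hU1' hph
      have hn : δ / 3 ≤ ‖U - consState r w ϑ‖ := by
        linarith [stateDist_le_norm U (consState r w ϑ)]
      have hmin : min ((δ / 3) ^ 2) (δ / 3) ≤
          min (‖U - consState r w ϑ‖ ^ 2) ‖U - consState r w ϑ‖ :=
        min_le_min (pow_le_pow_left₀ (by positivity) hn 2) hn
      calc min (mI / 2 * min ((δ / 3) ^ 2) (δ / 3)) (ρm / 4)
          ≤ mI / 2 * min ((δ / 3) ^ 2) (δ / 3) := min_le_left _ _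
        _ ≤ mI / 2 * min (‖U - consState r w ϑ‖ ^ 2) ‖U - consState r w ϑ‖ :=
          mul_le_mul_of_nonneg_left hmin (by positivity)
        _ ≤ _ := hb
    · have H := hcone r w ϑ h1 h2 h3 h4 h5 U hU1 hU2 hU3
      have hlog : -(2 * t) ≤ U.1 * Real.log U.1 := mul_log_ge_of_le_sq hU1 hsmall ht0
      have hρt : U.1 ≤ t := hsmall.trans (by nlinarith)
      have hCρ : Cmax * U.1 ≤ Cmax * t := mul_le_mul_of_nonneg_left hρt hCmax0
      have hE0 : 0 ≤ U.2.2 / (4 * θM) := by positivity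
      calc min (mI / 2 * min ((δ / 3) ^ 2) (δ / 3)) (ρm / 4) ≤ ρm / 4 := min_le_right _ _
        _ ≤ hsRelEta σ U (consState r w ϑ) := by linarith

end Summit.AtomisticToContinuum.HydrodynamicLimit.Theorems.AWS

end
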